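import Summits.CriticalPhenomena.Ising3DConformalLimit.Theorems.EnergyNotSigmaSquaredMoebiusLimitExistsLocallyBounded
import Mathlib.Topology.MetricSpace.Algebra
import HarnessLib

/-!
# The cluster set of the pinned critical zoom is invariant under the renormalised scaling flow
(line `only-interaction-breaks-moebius`, crux `MoebiusLimitExists`, item stmt-CriticalPhenomena-1344, route
`EnergyNotSigmaSquared`; structure of the objects of the residues 5′/6′)

Under the two-point law `⟨σ₀σ_y⟩_{β_c}‖y‖₂^{2Δ} → c > 0` (item stmt-0634's data) the pinned renormalisation is
regularly varying, `ρ_pin(δ/t)/ρ_pin(δ) → t^Δ` (`tendsto_rhoPin_ratio_sc`), and the pinned zoom at mesh `δ/t` is the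
pinned zoom at mesh `δ` read at the dilated configuration, `F_{δ/t}(x) = (ρ_pin(δ/t)/ρ_pin(δ))ⁿ F_δ(t x)`
(`rescaledCorrelator_div_sc`: the lattice approximation commutes exactly with `x ↦ t x`, `δ ↦ δ/t`). Hence
(`IsClusterPoint.dilate_sc`): if `S` is a cluster point of the pinned zoom, continuous off the diagonals, along the mesh
sequence `u_k`, then for every `t > 0` the RENORMALISED DILATE `x ↦ t^{nΔ} S_n(t x)` is a cluster point (along
`u_k / t`). The cluster set is thus invariant under the one-parameter renormalisation-group flow `S ↦ t^{nΔ} S(t ·)`,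
whose fixed points are exactly the scale-covariant families; the residue 6′ (non-drift) says the flow is trivial on
the interacting stratum. No definitions.
-/

noncomputable section

open Filter Topology Set Function Metric
open Literature.Probability.LatticeModels

namespace Summit.CriticalPhenomena.Ising3DConformalLimit.MoebiusLimitExistsOnlyInteraction

/-! ### The lattice approximation and the pinned zoom under `δ ↦ δ/t`, `x ↦ t x` -/

/-- `[p/(δ/t)] = [t p/δ]`. [folklore] -/
theorem latticeApprox_div_sc (δ t : ℝ) (p : EuclideanSpace ℝ (Fin 3)) :
    latticeApprox (δ / t) p = latticeApprox δ (t • p) := by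
  funext j
  rw [latticeApprox_apply, latticeApprox_apply, PiLp.smul_apply, smul_eq_mul, div_div_eq_mul_div, mul_comm]

/-- **The pinned zoom at mesh `δ/t` is the pinned zoom at mesh `δ` at the dilated configuration**, up to the ratio
of renormalisations: `F_{δ/t}(x) = (ρ_pin(δ/t)/ρ_pin(δ))ⁿ F_δ(t x)` (`ρ_pin(δ) ≠ 0`). [folklore] -/
theorem rescaledCorrelator_div_sc {δ : ℝ} (hρ : rhoPin δ ≠ 0) (t : ℝ) (n : ℕ)
    (x : Fin n → EuclideanSpace ℝ (Fin 3)) :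
    rescaledCorrelator (criticalCorr 3) rhoPin n (δ / t) x =
      (rhoPin (δ / t) / rhoPin δ) ^ n * rescaledCorrelator (criticalCorr 3) rhoPin n δ (fun i => t • x i) := by
  rw [rescaledCorrelator_apply, rescaledCorrelator_apply]
  simp only [latticeApprox_div_sc]
  rw [div_pow, ← mul_assoc, div_mul_cancel₀ _ (pow_ne_zero n hρ)]

/-! ### Regular variation of the pinned renormalisation -/

/-- `⟨σ₀σ_{⌊1/δ⌋e₀}⟩ > 0` for `δ ∈ (0, 1]` (`ρ_pin(δ)² = 1/⟨σ₀σ_{⌊1/δ⌋e₀}⟩ > 0`). [folklore] -/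
theorem criticalTwoPoint_pin_pos_sc {δ : ℝ} (hδ : δ ∈ Set.Ioc (0 : ℝ) 1) :
    0 < criticalTwoPoint 3 (Pi.single 0 (⌊1 / δ⌋ : ℤ) : Site 3) := by
  have h := pow_pos (rhoPin_pos δ hδ) 2
  rw [rhoPin_sq] at h
  exact inv_pos.1 h

/-- **`ρ_pin(δ/t)/ρ_pin(δ) → t^Δ` as `δ → 0⁺` under the two-point law** (`ρ_pin(δ)² = 1/⟨σ₀σ_{⌊1/δ⌋e₀}⟩` and
`⟨σ₀σ_{⌊1/δ⌋e₀}⟩ δ^{-2Δ} → c`). [cite: DuminilCopinICM2022, §8.1 eq. (8.1)–(8.2)] -/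
theorem tendsto_rhoPin_ratio_sc {Δ c : ℝ} (hc : 0 < c)
    (hG : Tendsto (fun y : Site 3 => criticalTwoPoint 3 y * Real.sqrt (∑ i, ((y i : ℝ)) ^ 2) ^ (2 * Δ))
      cofinite (𝓝 c))
    {u : ℕ → ℝ} (hu : Tendsto u atTop (𝓝[>] (0 : ℝ))) {t : ℝ} (ht : 0 < t) :
    Tendsto (fun k => rhoPin (u k / t) / rhoPin (u k)) atTop (𝓝 (t ^ Δ)) := by
  have hupos : ∀ᶠ k in atTop, 0 < u k := (tendsto_nhdsWithin_iff.1 hu).2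
  have hu0 : Tendsto u atTop (𝓝 0) := (tendsto_nhdsWithin_iff.1 hu).1
  have hu1 : ∀ᶠ k in atTop, u k ≤ min t 1 := hu0.eventually (ge_mem_nhds (by positivity))
  have hu' : Tendsto (fun k => u k / t) atTop (𝓝[>] (0 : ℝ)) := by
    refine tendsto_nhdsWithin_iff.2 ⟨by simpa using hu0.div_const t, ?_⟩
    filter_upwards [hupos] with k hk
    exact div_pos hk ht
  have ha := tendsto_criticalTwoPoint_pin_mul_rpow hG hu
  have hb := tendsto_criticalTwoPoint_pin_mul_rpow hG hu'
  have hT : t ^ (2 * Δ) = (t ^ Δ) ^ 2 := by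
    rw [mul_comm, Real.rpow_mul ht.le, Real.rpow_two]
  -- both meshes in `(0, 1]` and the ratio positive, eventually
  have hmem : ∀ᶠ k in atTop, u k ∈ Set.Ioc (0 : ℝ) 1 ∧ u k / t ∈ Set.Ioc (0 : ℝ) 1 := by
    filter_upwards [hupos, hu1] with k hk hk1
    refine ⟨⟨hk, hk1.trans (min_le_right _ _)⟩, div_pos hk ht, ?_⟩
    rw [div_le_one ht]
    exact hk1.trans (min_le_left _ _)
  -- the squared ratio
  have hsq : Tendsto (fun k => (rhoPin (u k / t) / rhoPin (u k)) ^ 2) atTop (𝓝 ((t ^ Δ) ^ 2)) := by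
    have hlim : Tendsto (fun k =>
        (criticalTwoPoint 3 (Pi.single 0 (⌊1 / u k⌋ : ℤ) : Site 3) * u k ^ (-(2 * Δ))) /
        (criticalTwoPoint 3 (Pi.single 0 (⌊1 / (u k / t)⌋ : ℤ) : Site 3) * (u k / t) ^ (-(2 * Δ))) *
        t ^ (2 * Δ)) atTop (𝓝 (c / c * t ^ (2 * Δ))) :=
      (ha.div hb hc.ne').mul_const _
    rw [div_self hc.ne', one_mul, hT] at hlim
    refine hlim.congr' ?_
    filter_upwards [hmem] with k ⟨hk, hkt⟩
    have hG1 := criticalTwoPoint_pin_pos_sc hk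
    have hG2 := criticalTwoPoint_pin_pos_sc hkt
    have hA : 0 < u k ^ (2 * Δ) := Real.rpow_pos_of_pos hk.1 _
    have hTp : 0 < t ^ (2 * Δ) := Real.rpow_pos_of_pos ht _
    rw [div_pow, rhoPin_sq, rhoPin_sq, inv_div_inv, Real.rpow_neg hk.1.le, Real.rpow_neg hkt.1.le,
      Real.div_rpow hk.1.le ht.le]
    field_simp
    rw [hT]
  -- take square roots
  have hsqrt := hsq.sqrt
  rw [Real.sqrt_sq (Real.rpow_nonneg ht.le Δ)] at hsqrt
  refine hsqrt.congr' ?_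
  filter_upwards [hmem] with k ⟨hk, hkt⟩
  exact Real.sqrt_sq (div_pos (rhoPin_pos _ hkt) (rhoPin_pos _ hk)).le

/-! ### The renormalised dilate of a cluster point is a cluster point -/

/-- Dilation by `t ≠ 0` preserves non-coincidence. [folklore] -/
theorem smul_mapsTo_nonCoincident_sc {t : ℝ} (ht : t ≠ 0) (n : ℕ) :
    MapsTo (fun x : Fin n → EuclideanSpace ℝ (Fin 3) => fun i => t • x i) (NonCoincident 3 n)
      (NonCoincident 3 n) := by
  intro x hx
  rw [mem_nonCoincident] at hx ⊢
  intro i j h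
  exact hx (smul_right_injective _ ht h)

/-- **THE CLUSTER SET IS INVARIANT UNDER THE RENORMALISED SCALING FLOW.** Under the two-point law, if `S` is a
cluster point of the pinned critical zoom, continuous off the diagonals, then for every `t > 0` so is its renormalised
dilate `x ↦ t^{nΔ} S_n(t x₁, …, t xₙ)` (along the mesh sequence divided by `t`): `F_{u_k/t}(x) =
(ρ_pin(u_k/t)/ρ_pin(u_k))ⁿ F_{u_k}(t x) → t^{nΔ} S_n(t x)` locally uniformly off the diagonals
(`rescaledCorrelator_div_sc`, `tendsto_rhoPin_ratio_sc`, composition with the dilation and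
`TendstoLocallyUniformlyOn.mul₀`). [cite: DuminilCopinICM2022, §8.1 eq. (8.1)–(8.2)] -/
theorem IsClusterPoint.dilate_sc {Δ c : ℝ} (hc : 0 < c)
    (hG : Tendsto (fun y : Site 3 => criticalTwoPoint 3 y * Real.sqrt (∑ i, ((y i : ℝ)) ^ 2) ^ (2 * Δ))
      cofinite (𝓝 c))
    {S : CorrFamily 3} (hS : IsClusterPoint S) (hcont : ∀ n, ContinuousOn (S n) (NonCoincident 3 n))
    {t : ℝ} (ht : 0 < t) :
    IsClusterPoint (fun n x => t ^ ((n : ℝ) * Δ) * S n (fun i => t • x i)) := by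
  obtain ⟨u, hu, hconv⟩ := hS
  have hupos : ∀ᶠ k in atTop, 0 < u k := (tendsto_nhdsWithin_iff.1 hu).2
  have hu0 : Tendsto u atTop (𝓝 0) := (tendsto_nhdsWithin_iff.1 hu).1
  have hu1 : ∀ᶠ k in atTop, u k ≤ 1 := hu0.eventually (ge_mem_nhds one_pos)
  have hu' : Tendsto (fun k => u k / t) atTop (𝓝[>] (0 : ℝ)) := by
    refine tendsto_nhdsWithin_iff.2 ⟨by simpa using hu0.div_const t, ?_⟩
    filter_upwards [hupos] with k hk
    exact div_pos hk ht
  refine ⟨fun k => u k / t, hu', fun n => ?_⟩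
  have hmaps := smul_mapsTo_nonCoincident_sc ht.ne' n
  have hgc : Continuous fun x : Fin n → EuclideanSpace ℝ (Fin 3) => fun i => t • x i :=
    continuous_pi fun i => (continuous_apply i).const_smul t
  -- the zoom at the dilated configurations converges to `S ∘ dilation`
  have h1 := (hconv n).comp (fun x : Fin n → EuclideanSpace ℝ (Fin 3) => fun i => t • x i) hmaps hgc.continuousOn
  -- the renormalisation ratios converge to `t^{nΔ}`
  have h2 : TendstoLocallyUniformlyOn (fun k (_ : Fin n → EuclideanSpace ℝ (Fin 3)) =>
      (rhoPin (u k / t) / rhoPin (u k)) ^ n) (fun _ => (t ^ Δ) ^ n) atTop (NonCoincident 3 n) :=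
    (((tendsto_rhoPin_ratio_sc hc hG hu ht).pow n).tendstoUniformlyOn_const _).tendstoLocallyUniformlyOn
  have h3 := h2.mul₀ h1 continuousOn_const ((hcont n).comp hgc.continuousOn hmaps)
  -- identify both sides
  have hpow : (t ^ Δ) ^ n = t ^ ((n : ℝ) * Δ) := by
    rw [← Real.rpow_natCast, ← Real.rpow_mul ht.le, mul_comm]
  refine (h3.congr_inseparable ?_).congr_right fun x _ => ?_
  · filter_upwards [hupos, hu1] with k hk hk1
    intro x _
    refine Inseparable.of_eq ?_
    rw [Pi.mul_apply, Pi.mul_apply, Function.comp_apply,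
      rescaledCorrelator_div_sc (rhoPin_pos (u k) ⟨hk, hk1⟩).ne' t n x]
  · rw [Pi.mul_apply, Function.comp_apply, hpow]

/-- **Registered anchor** (`clusterPoint_dilate`): closed form of `IsClusterPoint.dilate_sc`.
[cite: DuminilCopinICM2022, §8.1 eq. (8.1)–(8.2)] -/
theorem clusterPoint_dilate :
    ∀ (Δ c : ℝ), 0 < c →
      Tendsto (fun y : Site 3 => criticalTwoPoint 3 y * Real.sqrt (∑ i, ((y i : ℝ)) ^ 2) ^ (2 * Δ))
        cofinite (𝓝 c) →
      ∀ (S : CorrFamily 3), IsClusterPoint S → (∀ n, ContinuousOn (S n) (NonCoincident 3 n)) →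
        ∀ t : ℝ, 0 < t → IsClusterPoint (fun n x => t ^ ((n : ℝ) * Δ) * S n (fun i => t • x i)) :=
  fun _ _ hc hG _ hS hcont _ ht => hS.dilate_sc hc hG hcont ht

end Summit.CriticalPhenomena.Ising3DConformalLimit.MoebiusLimitExistsOnlyInteraction

end
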